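import Mathlib
import HarnessLib
import HarnessLib.Audit
import Summits.HubbardSuperconductivity.Statement
import Literature.MathematicalPhysics.StatisticalMechanics.ComplexGradientStiffness
import Literature.MathematicalPhysics.StatisticalMechanics.AbkmPackageSlots
import Literature.MathematicalPhysics.StatisticalMechanics.AbkmPackageShrunkSlots
import Summits.HubbardSuperconductivity.HubbardSuperconductivity.Theorems.ComplexGFFStiffnessDefs
import HarnessLib.Audit.Status.Attr

/-!
Route: ComplexGFFStiffness

CLOSED (proved) 2026-08-31T22:03:56Z by operator:999:2524351 — reason: proved:Summit.HubbardSuperconductivity.HubbardSuperconductivity.Theorems.ComplexGFF4Stiffness_proof — note: PROVED close on director-hubbard g27 EVENT OF RECORD, REQUESTS l.69646 (2026-08-31T21:55:25Z): finish ALL PROVED, 0 open leaves; closers by name p835419 (27414 TwoKernelSkBound) p835463 (19154 HypACumulant) p835465 (19155 HypALocalTwoPoint) p835464 (27383 TwoPointGivenZ) p835577 (ComplexGFF4Stiffnes. The file is kept as the record of this route; refuted decls are indexed as negative knowledge (`ledger negatives`).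

# Route ComplexGFFStiffness — Volume-uniform stiffness of the complex gradient GFF⁴ model from an
ι-symmetric RG bound (ladder Hubbard rung H2-1′; class rung, not summit-closing)

RUNG ROUTE (D-0059/D-0061; ladder Hubbard H2, cell xylro-ideate rung 1′ — NOT summit-closing:
stiffness does not imply long-range order and this route moves no consumer Statement; it is filed so
that the one typed, referee-passed work-bound item of the H2 round lives on the ledger). It suffices
to show X = X1 ∧ X2, the two readings of hypothesis (A) for the complex ι-symmetric gradient
perturbation w_{g,u} = exp(−S_u − igX_u) of the lattice free field on (ℤ/L^N)^4: X1 = HypACumulant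
(an N-uniform bound C·|Λ|·|u|² on the second cumulant of the tilt response Y_u, with Z ≠ 0) and X2 =
HypALocalTwoPoint (an N-uniform O(g) bound on the nearest-neighbour cosine two-point function), each
for all large odd L and g ≤ g₀(L). Given X, the tree theorem
ComplexGradientGFF4.stiffness_tower_of_hypA (Literature, proved, incl. the Gaussian bound
CosLowerBoundAt (2/3)) yields the target T = ComplexGFF4Stiffness: Z ≠ 0, nearest-neighbour order
Re⟨cos(∂φ/√K)⟩ ≥ 1/2, and helicity modulus |Υ − |u|²| ≤ |u|²/2 (sharp: ≤ Cg²|u|²), uniformly in N.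
Lean: `∃ L₀ : ℕ, ∀ L : ℕ, Odd L → L₀ ≤ L → ∃ g₀ : ℝ, 0 < g₀ ∧
Literature.MathematicalPhysics.StatisticalMechanics.ComplexGradientGFF4.StiffnessAt L g₀ ∧ ∃ C : ℝ,
Literature.MathematicalPhysics.StatisticalMechanics.ComplexGradientGFF4.SharpStiffnessAt L g₀ C`

## Assembly
Pure logic over one tree theorem: ComplexGradientGFF4.stiffness_tower_of_hypA : X1 → X2 → T
(Literature/MathematicalPhysics/StatisticalMechanics/ComplexGradientStiffness.lean, proved; it
consumes the proved Gaussian bound cosLowerBoundAt_two_thirds and the bookkeeping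
stiffnessAt_of_bounds). The deciding theorem is closes (h₁ : HypACumulant) (h₂ : HypALocalTwoPoint)
: ComplexGFF4Stiffness, proved THROUGH the Assembly item (have hA : Assembly := fun a b =>
stiffness_tower_of_hypA a b; exact hA h₁ h₂): its binders are exactly the two cruxes, and all four
declared items (target = conclusion, two cruxes = binders, Assembly = used in the proof term) lie in
the cone of closes; the Assembly item itself is closed by the same one-liner in a Theorems file
right after birth.

CLOSES_TARGET: closes rung H2gff of HubbardSuperconductivity: Summit.HubbardSuperconductivity.HubbardSuperconductivity.Theses.ComplexGFFStiffness.ComplexGFF4Stiffness (D-0061; not the summit Statement) — the deciding theorem of this route concludes that registered leaf instead of the Statement decl `HubbardSuperconductivity` (class rung: servable and labelled, never counted as concluding the summit Statement).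

Rationale: WHY THIS LINE. The helicity modulus of the complex-weight model IS the zero-twist Hessian of −log
Z/|Λ| (FisherBarberJasnow1973 eqs. (2.4)–(2.5); proved branch-free in the tree:
ComplexGradientGFF4.upsilon_eq_logZ_hessian), and its deviation from the Gaussian value |u|² is g²
times a second cumulant that is itself the ε-Hessian of a perturbed free energy along a REAL
exponential tilt staying inside the ι-symmetric class (upsilon_eq_mgfHessian). Hence an N-uniform
bound on the first two derivatives of the finite-volume perturbative free energy 𝒲_N —
AdamsBuchholzKoteckyMuller2019 (arXiv:1910.13564) Thm 2.2, printed for REAL finite-range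
perturbations — is exactly what X1/X2 ask, for the complex perturbation 𝒦_g = e^{−ig𝒦} − 1 with
𝒦_g(−z) = conj 𝒦_g(z). Imported area: rigorous multiscale renormalisation group for gradient
interface models (AdamsKoteckyMuller2016, BrydgesSlade2015RGI norms are Banach-algebra norms, so the
printed contraction estimates are insensitive to complex coefficients; the Gaussian side needs the
tuned quadratic form real, which ι-symmetry supplies — LIT audit R28/R30 of the cell). What no prior
route does: BalabanIR's crux BirComplexStableXYR (stmt-14845) wants a complex-stable RG for the
quantum XY model; this route isolates the classical-gradient shadow where the printed RG applies
verbatim up to a transcription, and types the target so that the transcription note has a ledger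
home. Everything volume-INDEPENDENT is already proved in the tree (stiffness_fixedVolume,
cumulantBound_fixedVolume, localTwoPoint_fixedVolume): the cruxes are precisely the uniformity in N.

RANKED CRUXES. #0 ComplexGFF4Stiffness (target) — volume-uniform stiffness along the tower n = L^N
for all large odd L: ∃ L₀ ∀ L odd ≥ L₀ ∃ g₀ > 0 with StiffnessAt L g₀ (Z ≠ 0; Re⟨cos(∂_iφ(x)/√K)⟩_g
≥ 1/2 for K ≥ 1; |Υ_n(g)[u] − |u|²| ≤ |u|²/2) and SharpStiffnessAt L g₀ C for some C. (why it might
fail: only through X1/X2: if the complex ι-symmetric perturbation leaves the domain of the printed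
RG (tuned covariance not real, or Z_N(g,0) = 0 for some large N at fixed small g) the N-uniformity
fails; fixed-volume truth is proved.) [AdamsBuchholzKoteckyMuller2019, FisherBarberJasnow1973]
#2 HypACumulant (crux) — hypothesis (A), cumulant form, N-uniform: ∃ L₀ ∀ L odd ≥ L₀ ∃ g₀ > 0, C:
for 0 ≤ g ≤ g₀, N ≥ 1, n = L^N: Z_n(g,0) ≠ 0 and ‖⟨Y_u²⟩_g − ⟨Y_u⟩_g²‖ ≤ C·|Λ|·|u|² for all twists u
(= [ABKM19] Thm 2.2, ℓ = 2, along the real tilt ε ↦ (1+𝒦_g)e^{εQ_u} − 1, transcribed to the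
ι-symmetric complex class). [difficulty: L] (why it might fail: Thm 2.2 is printed for REAL 𝒦; over
ℂ the fine-tuning step (Lemma 12.6 → Def. 6.5) needs the tuned quadratic form q_N real — true on the
ι-symmetric class only if every RG map preserves ι-symmetry (three loci to initial: R₁ p.73, 𝒯/K₀
p.93, I(𝒦) p.95); a hidden non-equivariant step kills it.) [AdamsBuchholzKoteckyMuller2019,
arXiv:1606.09541, arXiv:1403.7244]
#3 HypALocalTwoPoint (crux) — hypothesis (A), local two-point form, N-uniform: ∃ L₀ ∀ L odd ≥ L₀ ∃
g₀ > 0, C: for 0 ≤ g ≤ g₀, N ≥ 1, n = L^N, K ≥ 1, every site x and axis i: Z_n(g,0) ≠ 0 and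
‖⟨cos(∂_iφ(x)/√K)⟩_g − ⟨cos(∂_iφ(x)/√K)⟩_0‖ ≤ C·g (= Thm 2.2, ℓ = 1, along t ↦ t𝒦_g paired with the
bounded-range observable cos(z_i/√K), transcribed to the ι-symmetric class). [difficulty: L] (why it
might fail: the printed observable machinery gives bounded-range correlations via tangents of 𝒲_N
only for perturbations in the Banach space E of the paper; cos(z_i/√K)·(1+𝒦_g) must lie in E with
norm O(1) UNIFORMLY in K ≥ 1 — the K-uniformity of the ζ-norm is unchecked.)
[AdamsBuchholzKoteckyMuller2019, arXiv:2007.10869]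

TWO-LAYER PLAN. Foreseen split of HypACumulant once a seat takes it: HypACumulant ⇐ (N5)
ι-equivariance of the RG map 𝒯 of [ABKM19] Ch. 12 (the real subspaces E^ι, M^ι are invariant; pure
symmetry bookkeeping over a typed interface for the RG data) → (N6) Thm 11.1/2.2 on B_ρ(0) ∩ E^ι
(the printed contraction + implicit-function argument run inside the real Banach subspaces) → (N7)
chain rule: D²𝒲_N along the real tilt = the cumulant (calculus; the finite-volume identity is
upsilon_eq_mgfHessian). HypALocalTwoPoint ⇐ (N6) → (N8) two-term formula for the tangent of 𝒲_N
against cos(z_i/√K) with a K-uniform norm bound. Nothing of N5–N8 is filed now; the typed RG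
interface (the cell's D1) is the first definition request of the seat that claims K1. BC3 BIRTH
SKELETON (typed over tree declarations, farm-checked inline before open, published as
Cruxes/<Decl>/Lines/birth.lean after open): HypACumulant ⇐ ZNonvanishing (N-uniform non-vanishing
Z_{L^N}(g,0) ≠ 0 for all N at fixed small g — the representation half of the RG, Z_N =
e^{−|Λ|𝒲_N}·(1 + small)) + CumulantGivenZ (the ℓ = 2 derivative bound GIVEN Z ≠ 0 — the smoothness
half); HypALocalTwoPoint ⇐ ZNonvanishing + TwoPointGivenZ (ℓ = 1); both compositions proved (merge
L₀ by max, g₀ by min), sorries only in the three stubs, and no stub cheaply gives its crux or the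
summit (7 `#h21_crux_probe` CLEAN). The BC5 rung is PLAN-ONLY: stub_zNonvanishing (outside the
target's known regime — only fixed-volume non-vanishing with g₀ = g₀(n) is a theorem — and it
exercises the lever: reaching every N needs the full multiscale flow on E^ι).

KILL CRITERIA. Refutation of HypACumulant or HypALocalTwoPoint by an explicit family (L, g_N → fixed
g, N → ∞) with Z_{L^N}(g,0) = 0 or an unbounded cumulant closes the route (close --reason
refuted:<Decl>); a proof that the tuned covariance q_N(𝒦_g) is NOT real for the ι-symmetric class
(failure of N5) forces a pivot to general-complex fine tuning (new mathematics: Def. 6.5 over ℂ) —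
then retire as exhausted. A Literature landing of Thm 2.2-on-E^ι as a cited fact would turn both
cruxes into (h : Fact) → … supports and moot the route as a research line (it then closes by
citation).

NOT DECOMPOSED YET. The RG interface D1 (polymer activities, norms ‖·‖_ζ, the maps 𝒯, fine-tuning
q(ℋ)) is deliberately not typed at open: it is ~20–60 declarations of a Literature SECTION (one file
per section, D-0064) and belongs to the seat that claims HypACumulant; constants (ρ, ω₀, κ(L),
g₀(L)) stay existential; the K-uniformity in HypALocalTwoPoint is not split off until N8 is written.

CHEAPEST FALSIFIER. N = 1 → N = 2 with L-uniform constants for the cumulant bound (one genuine RG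
step on the ι-symmetric class, L = 3,5,7): if the one-step map already fails to keep the tuned
quadratic form real (a 4×4 symbolic computation in the second-order Taylor coefficients: ι acts by
conj/−conj/conj on orders 0/1/2), HypACumulant is dead at N5. Lookup already run: the cell's LIT
audit R28/R30 (SOURCES §R, pages p0073/p0093/p0095/p0099 of arXiv:1910.13564 opened) found every
constituent map ι-equivariant — NOT ADVERSE; no refuter has run the symbolic one-step check.

NUMBERS. d = 4, one component, rank-one zero-mode mass; L odd ≥ L₀ and g₀ = g₀(L) as in [ABKM19] Thm
2.2 (p.8 of arXiv:1910.13564, L113–140 of the held text); Gaussian constants proved in the tree: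
⟨(∂_iφ(x))²⟩_0 ≤ 2/3, Re⟨cos(∂_iφ/√K)⟩_0 ≥ 2/3 (cosLowerBoundAt_two_thirds); display thresholds 1/2
in clauses (b),(c) are implied by the sharp O(g)/O(g²) forms for small g₀ (checklist 4c(iv):
SharpStiffnessAt carries ∃ C, no hand-picked rate).

DEFINITION REQUESTS. None at open. Foreseen (by the claiming seat, not now): D1 = the
[ABKM19]/[AKM16] RG data as a Literature section
(Literature/MathematicalPhysics/StatisticalMechanics/GradientRG/…: finite-range decomposition,
norms, the map 𝒯, Thm 2.2 as a cited fact for REAL perturbations), so that N5–N8 can be stated over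
it.

Novelty: Searches (2026-08-25, P3 g6–g8 of the cell; corpus fts+vec AND galaxy): lit search --hybrid
"helicity modulus renormalisation group gradient model complex perturbation uniform in volume" (8
textbook hits, none on topic: baulieu2017, rivasseau1991, glimm1985 …); lit vsearch "<RG for
gradient models with complex perturbation; stiffness as second derivative of the free energy in the
tilt>" (8 textbook hits, none); lit galaxy search "helicity modulus|superfluid stiffness|gradient
Gibbs" --star all (20 rows: friedli–velenik, BKT reviews, FBJ-type physics; no RG theorem for
complex gradient measures); cell record SOURCES §R R28/R30 (arXiv:1910.13564 read page by page on
the ι-symmetric class), lean search (no StiffnessAt/CumulantBoundAt/… decl before the W-P3 landing;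
only other Upsilon = KlainermanSzeftel2021.Setup). ledger negatives --problem
HubbardSuperconductivity: 6 refuted statements (KkFloor ×3, ColourTheSpin, CooperPairDMottWalk,
AposterioriCapRg) — none about gradient measures or stiffness.
Nearest prior art found: AdamsBuchholzKoteckyMuller2019 Thm 2.2/2.3/2.6 (arXiv:1910.13564 p.8–9:
N-uniform smoothness and strict convexity of the finite-volume free energy for REAL small
finite-range perturbations — the sibling statement, decided in print); arXiv:2007.10869 (Hilger:
observables for gradient models, to first order); arXiv:2211.14367 (complex observables for d = 2
discrete Gaussian with a real bulk); tree: route BalabanIR crux BirComplexStableXYR (stmt-14845) and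
its cru  [refs: 1910.13564, 2007.10869, 2211.14367, KlainermanSzeftel2021, AdamsBuchholzKoteckyMuller2019]

Barriers (technique_class: multiscale-rg, gradient-gibbs, complex-measure): - technique_class: multiscale-rg, gradient-gibbs, complex-measure
- Literature.Barriers.HubbardSuperconductivity.HohenbergMerminWagnerPairing: does not apply — the
barrier quantifies over d ≤ 2 / T > 0 continuous-symmetry LRO; the route is D = 4, classical, and
claims NO long-range order (stiffness only).
- Literature.Barriers.HubbardSuperconductivity.PositiveTemperatureNoPairLRO: does not apply — same
reason (no LRO claim; no pairing operator).
- Literature.Barriers.HubbardSuperconductivity.InfraredBoundNeelSpinHalf2D: does not apply — the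
route uses no reflection positivity / infrared bound; the complex weight is outside the RP class by
construction (that is the point of the line).
- Literature.Barriers.HubbardSuperconductivity.WeakCouplingCeiling: does not apply — a ceiling on
fermionic weak-coupling perturbation theory for the Hubbard model; different object (classical
gradient measure), and the route's small parameter g enters a convergent RG, not a truncated series.
- Literature.Barriers.HubbardSuperconductivity.PerturbativeInvisibilityOfPairing: does not apply —
no pairing observable; the target is a free-energy Hessian.
- Literature.Barriers.HubbardSuperconductivity.SignProblemNPHard: does not apply — complexity of
sampling oscillatory weights is not a proof barrier for a norm-based RG bound; the bet is exactly
that ι-symmetry keeps the tuned Gaussian data real so no sampling/positivity is ever used.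
- Negatives index: the 6 refuted statements of the summit (KkFloorKk

History (route lifecycle, newest last):
- 2026-08-26T10:50:58Z · closes_target -> closes rung H2gff of HubbardSuperconductivity: Summit.HubbardSuperconductivity.HubbardSuperconductivity.Theses.ComplexGFFStiffness.ComplexGFF4Stiffness (D-0061; not the summit Statement) (planner-director-hubbard-g6-0)
- 2026-08-31T14:33:26Z · rev 5: restated TwoKernelSkBound (stmt-HubbardSuperconductivity-27377), F4StatementOfCores (stmt-HubbardSuperconductivity-27379), H1bcStatement (stmt-HubbardSuperconductivity-27380), F1Residual (stmt-HubbardSuperconductivity-27381) — cstrat-19154 g1 (director-hubbard g26 docket, ladder REQUESTS l.67476; cgffstiff-1 g14 (planner-cstrat-stmt-HubbardSuperconductivity-19154-g1-0)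
- 2026-08-31T14:33:26Z · rev 5: informal re-worded for HypACumulantGlue, HypALocalTwoPointGlue (planner-cstrat-stmt-HubbardSuperconductivity-19154-g1-0)
- 2026-08-31T22:03:56Z · CLOSED proved — proved:Summit.HubbardSuperconductivity.HubbardSuperconductivity.Theorems.ComplexGFF4Stiffness_proof (operator:999:2524351)

sub-problem: HubbardSuperconductivity · status: closed(proved) · opened planner-xylro-ideate-p3-g10-0 2026-08-26T00:04:04Z · rev 5 · ledger route-HubbardSuperconductivity-ComplexGFFStiffness
GENERATED by the gate from the ledger (D-0016/17). Provers cite these decls: `theorem foo : Summit.HubbardSuperconductivity.HubbardSuperconductivity.Theses.ComplexGFFStiffness.<Decl> := …` in Summits/HubbardSuperconductivity/HubbardSuperconductivity/Theorems/<Name>.lean.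
-/

namespace Summit.HubbardSuperconductivity.HubbardSuperconductivity.Theses.ComplexGFFStiffness

open scoped BigOperators Topology Manifold Classical MeasureTheory ProbabilityTheory Matrix InnerProductSpace ComplexConjugate ContinuousMap
open Filter Set Function TopologicalSpace MeasureTheory

attribute [summit_statement] _root_.HubbardSuperconductivity
-- H21.Audit: the closer leaf Summit.HubbardSuperconductivity.HubbardSuperconductivity.Theses.ComplexGFFStiffness.ComplexGFF4Stiffness is an item decl of this route file — tagged summit_statement below, after its declaration

open Literature.Hubbard

/-! Retired items kept as plain definitions (history; not obligations of this route): landed proofs / closed glue still name them. -/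

/-- retired stmt-HubbardSuperconductivity-27383 (moot, gen 1) — named by an active item. -/
def TwoPointGivenZ : Prop :=
  Summit.HubbardSuperconductivity.HubbardSuperconductivity.Theorems.ComplexGFF.TwoPointGivenZ

/-- item stmt-HubbardSuperconductivity-19153 · target · rank 0 · closed · proved by Summit.HubbardSuperconductivity.HubbardSuperconductivity.Theorems.ComplexGFF4Stiffness_proof (prover) · by planner
why it might fail: only through X1/X2: if the complex ι-symmetric perturbation leaves the domain of the printed RG (tuned covariance not real, or Z_N(g,0) = 0 for some large N at fixed small g) the N-uniformity fails; fixed-volume truth is proved.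
sources: AdamsBuchholzKoteckyMuller2019, FisherBarberJasnow1973
[target] volume-uniform stiffness along the tower n = L^N for all large odd L: ∃ L₀ ∀ L odd ≥ L₀ ∃
g₀ > 0 with StiffnessAt L g₀ (Z ≠ 0; Re⟨cos(∂_iφ(x)/√K)⟩_g ≥ 1/2 for K ≥ 1; |Υ_n(g)[u] − |u|²| ≤
|u|²/2) and SharpStiffnessAt L g₀ C for some C. -/
@[route_item "route-HubbardSuperconductivity-ComplexGFFStiffness"]
def ComplexGFF4Stiffness : Prop :=
  ∃ L₀ : ℕ, ∀ L : ℕ, Odd L → L₀ ≤ L → ∃ g₀ : ℝ, 0 < g₀ ∧ Literature.MathematicalPhysics.StatisticalMechanics.ComplexGradientGFF4.StiffnessAt L g₀ ∧ ∃ C : ℝ, Literature.MathematicalPhysics.StatisticalMechanics.ComplexGradientGFF4.SharpStiffnessAt L g₀ C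

-- `ComplexGFF4Stiffness` holds: proved by `Summit.HubbardSuperconductivity.HubbardSuperconductivity.Theorems.ComplexGFF4Stiffness_proof` (its module imports this route file, so no `_holds` link can be stated here).

/-- item stmt-HubbardSuperconductivity-19154 · crux · rank 2 · closed · proved by Summit.HubbardSuperconductivity.HubbardSuperconductivity.Theorems.HypACumulant_proof (prover) · by planner
why it might fail: Thm 2.2 is printed for REAL 𝒦; over ℂ the fine-tuning step (Lemma 12.6 → Def. 6.5) needs the tuned quadratic form q_N real — true on the ι-symmetric class only if every RG map preserves ι-symmetry (three loci to initial: R₁ p.73, 𝒯/K₀ p.93, I(𝒦) p.95); a hidden non-equivariant step kills it.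
sources: AdamsBuchholzKoteckyMuller2019, arXiv:1606.09541, arXiv:1403.7244
retired/moot children: TwoKernelSkBound [replaced: Literature.MathematicalPhysics.StatisticalMechanics.GradientRG.TwoKernelSkBound ]; F4StatementOfCores [replaced: Literature.MathematicalPhysics.StatisticalMechanics.GradientRG.TwoKernelSkBound ]; H1bcStatement [replaced: Literature.MathematicalPhysics.StatisticalMechanics.GradientRG.H1bcStatement 4]; F1Residual [replaced: Literature.MathematicalPhysics.StatisticalMechanics.GradientRG.F4Statement 4 → L]
[crux] hypothesis (A), cumulant form, N-uniform: ∃ L₀ ∀ L odd ≥ L₀ ∃ g₀ > 0, C: for 0 ≤ g ≤ g₀, N ≥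
1, n = L^N: Z_n(g,0) ≠ 0 and ‖⟨Y_u²⟩_g − ⟨Y_u⟩_g²‖ ≤ C·|Λ|·|u|² for all twists u (= [ABKM19] Thm
2.2, ℓ = 2, along the real tilt ε ↦ (1+𝒦_g)e^{εQ_u} − 1, transcribed to the ι-symmetric complex
class). [difficulty: L] -/
@[route_item "route-HubbardSuperconductivity-ComplexGFFStiffness", crux]
def HypACumulant : Prop :=
  ∃ L₀ : ℕ, ∀ L : ℕ, Odd L → L₀ ≤ L → ∃ g₀ C : ℝ, 0 < g₀ ∧ Literature.MathematicalPhysics.StatisticalMechanics.ComplexGradientGFF4.CumulantBoundAt L g₀ C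

-- `HypACumulant` holds: proved by `Summit.HubbardSuperconductivity.HubbardSuperconductivity.Theorems.HypACumulant_proof` (its module imports this route file, so no `_holds` link can be stated here).

-- parent: HypACumulant · child (gen 1)
/--     item stmt-HubbardSuperconductivity-27414 · crux · rank 201 · closed · proved by Summit.HubbardSuperconductivity.HubbardSuperconductivity.Theorems.TwoKernelSkBound_proof (prover)
    parent: HypACumulant · by planner
    why it might fail: N-uniformity of l_T, l_TT needs the exact per-connected-polymer pairing of the two (at ℓ = 2: three) polymer expansions — counting gives L^{dN}-type constants; a loss in the large-set bookkeeping at fixed A leaves residual N-dependence, fatal for F1Residual.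
    sources: AdamsBuchholzKoteckyMuller2019, Lemma 12.6 (12.53) / Lemma 8.4 / Thm 6.8, arXiv:1910.13564, p822871 LinearisedMapKernelSubUnifTorusFRD, HOME lean/QLIPSCHITZ3-DONE-cgffstiff1-g12-v3.md §4
[crux · L+] the N-FREE two-kernel S_k bundle [ABKM19] (12.53) at ℓ = 1 AND ℓ = 2: (i)
TwoKernelSkBound 4 — for every d = 4 package P an N-free l_T ≥ 0 with slot (F4l) (‖S_q(u,v) −
S_q'(u,v)‖_{k+1} ≤ l_T|q−q'|₁ max(‖u‖,‖v‖), state ball of FULL radius P.r: it is the uniform bound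
the holomorphic F4l′ estimate of F4StatementOfCores consumes on the P.r-ball) AND (ii) F4l2Shrink 4
— for every package P an N-free l_TT ≥ 0 with slot (F4l2) (mixed second q-differences of q ↦
S_q(u,v)) for the SHRUNK package P.shrink (states in the P.r/8-ball; the weakest form the
free-energy assembly uses; the full-radius family implies it by P ↦ P.shrink, f4l2Shrink_of_full in
the evidence file). RE-TYPED 2026-08-31 (cstrat-19154 g1; director-hubbard g26 docket (R1)/(R4),
ladder REQUESTS l.67476): F4l2 moved HERE from F4StatementOfCores because the shrink repair (R1)
does not produce it — it needs the same Banach-grade two-kernel machinery as F4l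
(per-connected-polymer pairing of the two polymer expansions). Vocabulary: AbkmPackageSlots
(p823650), AbkmPackageShrink (p824993), AbkmPackageShrunkSlots (p825648). Tree: F4l with an
N-DEPENDENT constant (exists_activityNormLE_rgSQ_sub_of_torusFRD, Brouwer-grade -/
@[route_item "route-HubbardSuperconductivity-ComplexGFFStiffness", crux (bottleneck := work) (source := "ledger D-0171 leaf tag ATTACKABLE on stmt-HubbardSuperconductivity-27414, 2026-09-01")]
def TwoKernelSkBound : Prop :=
  Literature.MathematicalPhysics.StatisticalMechanics.GradientRG.TwoKernelSkBound 4 ∧ Literature.MathematicalPhysics.StatisticalMechanics.GradientRG.F4l2Shrink 4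

-- `TwoKernelSkBound` holds: proved by `Summit.HubbardSuperconductivity.HubbardSuperconductivity.Theorems.TwoKernelSkBound_proof` (its module imports this route file, so no `_holds` link can be stated here).

-- parent: HypACumulant · child (gen 1)
/--     item stmt-HubbardSuperconductivity-27378 · crux · rank 202 · closed · proved by Summit.HubbardSuperconductivity.HubbardSuperconductivity.Theorems.L2GaussianCore_proof (prover)
    parent: HypACumulant · by planner
    why it might fail: the trace-second covariance comparison must be subdivided along the parallelogram with N-free accumulated constants in the Taylor norm (TayNorm version not in the tree); the k-dependence ‘4qk’ has to be absorbed by the field-weight scaling h_k, else φ_TT / b_TT pick up a factor N.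
    sources: AdamsBuchholzKoteckyMuller2019, Lemma 8.4 (ℓ = 2), arXiv:1910.13564, p823175 GaussianCovarianceComparisonTraceSecond, HOME lean/QLIPSCHITZ3-DONE-cgffstiff1-g12-v3.md §3
[crux · L] the two ℓ = 2 slots that need ONLY the second-order Gaussian fluctuation engine: for
every d = 4 package N-free b_TT, φ_TT ≥ 0 with (F4b2) (parallelogram second differences of q ↦ B_q v
in operator norm ≤ b_TT |y|₁|z|₁‖v‖) and (F4Φ22) (of the last-scale functional q ↦ Φ_q(y₀) ≤ φ_TT
|y|₁|z|₁‖y₀‖) at every height. First-order halves landed (p822816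
hamNorm_opB_mid_sub_unif_of_torusFRD, p822745), small-step core landed (p823175
GaussianCovarianceComparisonTraceSecond: |E_{S₁}H + E_{S₂}H − 2E_{S₀}H| ≤ (100q²h² + 4qk)‖H‖;
p823236 StepMeasureComparisonTraceSecond). NODE: piece WEAKER (slot); leaf ATTACKABLE (subdivision
SecondDifferenceSubdivision + Taylor-norm plumbing; owner cgffstiff-1 g13 plan (i)–(iii)). -/
@[route_item "route-HubbardSuperconductivity-ComplexGFFStiffness", crux (bottleneck := work) (source := "ledger D-0171 leaf tag ATTACKABLE on stmt-HubbardSuperconductivity-27378, 2026-09-01")]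
def L2GaussianCore : Prop :=
  Literature.MathematicalPhysics.StatisticalMechanics.GradientRG.L2GaussianCore 4

-- `L2GaussianCore` holds: proved by `Summit.HubbardSuperconductivity.HubbardSuperconductivity.Theorems.L2GaussianCore_proof` (its module imports this route file, so no `_holds` link can be stated here).

-- parent: HypACumulant · child (gen 1)
/--     item stmt-HubbardSuperconductivity-27415 · crux · rank 203 · closed · proved by Summit.HubbardSuperconductivity.HubbardSuperconductivity.Theorems.F4StatementOfCores_proof (prover)
    parent: HypACumulant · by planner
    why it might fail: The Cauchy estimate needs S_q − S_q′ holomorphic and UNIFORMLY bounded by (F4l) of P on a bidisc of radius ~7r/16 around corners in the r/8-ball; if (F4l)'s real-state hypotheses ‖u‖ ≤ P.r, c_v ≤ P.r do not cover the complexified corners, l_T′ picks up N.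
    sources: AdamsBuchholzKoteckyMuller2019, Lemma 12.6 (12.53) / Thm 6.8 / Ch. 12 (12.4), arXiv:1910.13564, p825407 ComplexGFFStiffnessHolomorphicPackageLines, hubbard-search STATUS l.2953 (cgffstiff-1 g14 DIAGNOSIS)
[crux · M] the mixed q/state slot on the SHRUNK ball FROM the N-free two-kernel bound:
TwoKernelSkBound 4 → F4lPrimeShrink 4, i.e. given N-free (F4l) for every package, every d = 4
package P gets an N-free l_T′ ≥ 0 with slot (F4l′) (‖(S_q′ − S_q)(u,v) − (S_q′ − S_q)(u′,v′)‖_{k+1}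
≤ l_T′|q′−q|₁ max(‖u−u′‖,‖v−v′‖)) for P.shrink (state corners in the P.r/8-ball, Theorem 6.8 on the
P.r-ball) at every height. RE-TYPED 2026-08-31 (cstrat-19154 g1; director-hubbard g26 docket;
cgffstiff-1 g14 DIAGNOSIS hubbard-search STATUS l.2953): the slot AT FULL RADIUS P.r is unprovable
with the landed holomorphic toolchain (corners on the boundary of the Theorem-6.8 ball ⇒ bidisc
radius 0); g14's repair (R1) proves it for P.shrink by Cauchy estimates along complex state lines
(Theorems/ComplexGFFStiffnessHolomorphicPackageLines, p825407: weakNormLE_sub_nextKStep_pair_package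
— two-kernel difference Lipschitz ≤ (r₀+1)(2C_q/R)|σ| from the uniform bound (F4l) on the P.r-ball).
The former second half (F4l2) moved to TwoKernelSkBound; the other seven slots are theorems
((F4a,F4b,F4a2,F4Φ2) exists_f4first_unif, (F4b2,F4Φ22) l2GaussianCore) instantiated at P.shrink by
the glue (f4StatementShrink_of_cores, e -/
@[route_item "route-HubbardSuperconductivity-ComplexGFFStiffness", crux (bottleneck := work) (source := "ledger D-0171 leaf tag ATTACKABLE on stmt-HubbardSuperconductivity-27415, 2026-09-01")]
def F4StatementOfCores : Prop :=
  Literature.MathematicalPhysics.StatisticalMechanics.GradientRG.TwoKernelSkBound 4 → Literature.MathematicalPhysics.StatisticalMechanics.GradientRG.F4lPrimeShrink 4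

-- `F4StatementOfCores` holds: proved by `Summit.HubbardSuperconductivity.HubbardSuperconductivity.Theorems.F4StatementOfCores_proof` (its module imports this route file, so no `_holds` link can be stated here).

-- parent: HypACumulant · child (gen 1)
/--     item stmt-HubbardSuperconductivity-27416 · crux · rank 204 · closed · proved by Summit.HubbardSuperconductivity.HubbardSuperconductivity.Theorems.H1bcStatement_proof (prover)
    parent: HypACumulant · by planner
    why it might fail: Nothing left as typed — proved in the tree (h1bcStatement_shrink); the old risk (Cauchy estimates with all four corners at the full radius r) is exactly what the shrink removes (bidisc radius 7r/16; P.r = 0 handled apart).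
    sources: AdamsBuchholzKoteckyMuller2019, Thm 6.8 (smoothness of S) / Ch. 12 (12.4), arXiv:1910.13564, Theorems/ComplexGFFStiffnessH1Sigma2Shrink.lean (h1bcStatement_shrink), p825295 ComplexGFFStiffnessHolomorphicTorusFamily
[crux · M · PROVABLE NOW] census F5 = H1b/H1c, the STATE slot on the SHRUNK ball:
H1bcStatementShrink 4 — for every d = 4 package P an N-free σ₂ ≥ 0 with slot (H1σ2) (joint
parallelogram second differences of (u,v) ↦ S_q(u,v) at fixed q in the tuning ball, all four state
corners in the P.r/8-ball, Theorem 6.8 on the P.r-ball, all steps k+1 ≤ N, ≤ σ₂ max(‖y‖,c_y)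
max(‖z‖,c_z) in the activity norm) at every height. RE-TYPED 2026-08-31 (cstrat-19154 g1;
director-hubbard g26 docket; g14 DIAGNOSIS: the FULL-radius slot is unprovable with the holomorphic
toolchain — corners on the boundary of the Theorem-6.8 ball). IN TREE:
Summit.HubbardSuperconductivity.HubbardSuperconductivity.Theorems.ComplexGFF.h1bcStatement_shrink
(cgffstiff-1 g14, Theorems/ComplexGFFStiffnessH1Sigma2Shrink.lean; explicit size
(r₀+1)·4σ(r)r/(7r/16)²); closes by the one-liner `theorem … :
…Theses.ComplexGFFStiffness.H1bcStatement := fun P _ _ => Theorems.ComplexGFF.h1bcStatement_shrink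
P` (evidence SplitCheck.lean, h1bcStatement_closes). NODE (D-0171): piece WEAKER than the parent and
than the old full-radius text (h1bcStatement_new_of_old); leaf ATTACKABLE (provable now). -/
@[route_item "route-HubbardSuperconductivity-ComplexGFFStiffness", crux (bottleneck := work) (source := "ledger D-0171 leaf tag ATTACKABLE on stmt-HubbardSuperconductivity-27416, 2026-09-01")]
def H1bcStatement : Prop :=
  Literature.MathematicalPhysics.StatisticalMechanics.GradientRG.H1bcStatementShrink 4

-- `H1bcStatement` holds: proved by `Summit.HubbardSuperconductivity.HubbardSuperconductivity.Theorems.H1bcStatement_proof` (its module imports this route file, so no `_holds` link can be stated here).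

-- parent: HypACumulant · child (gen 1)
/--     item stmt-HubbardSuperconductivity-27417 · crux · rank 205 · closed · proved by Summit.HubbardSuperconductivity.HubbardSuperconductivity.Theorems.F1Residual_proof (prover)
    parent: HypACumulant · by planner
    why it might fail: Quantifier order: sizes come per package but ρ — hence the package, built at radius 8ρ — is fixed per L before the sizes; circular if InBall of hamTuningMap ρ h₀ (ρ·L_q ≤ T₀) or the ε-smallness needs the sizes first; the shrink costs a factor 8 in every radius-sensitive constant.
    sources: AdamsBuchholzKoteckyMuller2019, Thm 2.2 / Ch. 4 (4.4)–(4.12) / Lemma 12.6 / Ch. 12, arXiv:1910.13564, p825301 ComplexGFFStiffnessHypALocalTwoPointFreeEnergyPackage (exists_freeEnergyConsts_of_slots), hubbard-search INBOX l.1409 (cgffstiff-1 g14 → cgffstiff-2 g3), HOME lean/FREEENERGY-ASSEMBLY-cgffstiff2-g2.md §5–§7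
[crux · S–M] census F1, the RESIDUAL ASSEMBLY consuming the SHRUNK bundles: F4StatementShrink 4 →
H1bcStatementShrink 4 → FreeEnergyBounds (Theorems/ComplexGFFStiffnessDefs) — given, for EVERY
package P₀, N-free sizes of all nine q-slots and of the state slot for P₀.shrink, produce the
N-uniform C^{1,1} free-energy difference bounds on the ι-admissible ball. RE-TYPED 2026-08-31
(cstrat-19154 g1; director-hubbard g26 docket; cgffstiff-1 g14 → cgffstiff-2 g3, hubbard-search
INBOX l.1409): the per-L parameter choice exactly as in gnv_of_torusFRD (TorusFRD_holds 4; schedule,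
h, T₀, A, r), but build the TorusFRD package P₀ at state radius 8ρ (side conditions hv/hωA/hc3A/hc2A
at 8ρ) and run the flow / IsRGStepQ with P₀.shrink (radius ρ; isRGStepQ_abkm_of_stepKernelBounds
applies to P₀.shrink's own fields), q = hamTuningMap ρ h₀ (symmetric, |q|₁ ≤ T₀ on the ρ-ball:
parallelograms ↦ parallelograms), then the sizes from the two hypotheses AT P₀.shrink, then ε, ρ_𝒦;
N-uniform constants from exists_freeEnergyConsts_of_slots P₀.shrink (cgffstiff-2 g3, p825301: slots
at ONE package ⇒ C₂, C₃ before ∀ N) with the slot conversions p825071 / p825213. NODE (D-0171):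
piece WEAKER than the parent (con -/
@[route_item "route-HubbardSuperconductivity-ComplexGFFStiffness", crux (bottleneck := work) (source := "ledger D-0171 leaf tag ATTACKABLE on stmt-HubbardSuperconductivity-27417, 2026-09-01")]
def F1Residual : Prop :=
  Literature.MathematicalPhysics.StatisticalMechanics.GradientRG.F4StatementShrink 4 → Literature.MathematicalPhysics.StatisticalMechanics.GradientRG.H1bcStatementShrink 4 → Summit.HubbardSuperconductivity.HubbardSuperconductivity.Theorems.ComplexGFF.FreeEnergyBounds

-- `F1Residual` holds: proved by `Summit.HubbardSuperconductivity.HubbardSuperconductivity.Theorems.F1Residual_proof` (its module imports this route file, so no `_holds` link can be stated here).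

-- parent: HypACumulant · glue (gen 1)
/--     item stmt-HubbardSuperconductivity-27382 · support · rank 206 · closed · proved by Summit.HubbardSuperconductivity.HubbardSuperconductivity.Theorems.HypACumulantGlue_proof (planner)
    parent: HypACumulant · GLUE: children ⟹ parent · by planner
[glue] HypACumulantGlue : TwoKernelSkBound → L2GaussianCore → F4StatementOfCores → H1bcStatement →
F1Residual → HypACumulant, now over the RE-TYPED children (shrunk-package repair R1, cstrat-19154 g1
2026-08-31; this item's text is unchanged, its meaning follows the children). PROVED sorry-free (std
axioms) in the strategist's attached evidence file SplitCheck.lean /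
ComplexGFFStiffnessHypACumulantSplitShrunk.lean (theorem hypACumulantGlue: F4StatementShrink 4 from
TwoKernelSkBound 4 ∧ F4l2Shrink 4 + l2GaussianCore + F4lPrimeShrink 4 + exists_f4first_unif at
P.shrink (f4StatementShrink_of_cores); F1Residual gives FreeEnergyBounds ⟹
onePointLipschitz_of_freeEnergyBounds' ⟹ cumulantGivenZ_of_onePointLipschitz ⟹ merge with the landed
zNonvanishing, L₀ := max, g₀ := min). SUPERSEDES g0's ComplexGFFStiffnessHypACumulantSplit.lean
(stale: rev-4 child texts). Planners cannot write Theorems (perm.theorems-prover-only): ANY PROVER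
lands the attached by-name file `ledger propose --kind proof --target
Summits/HubbardSuperconductivity/HubbardSuperconductivity/Theorems/ComplexGFFStiffnessHypACumulantSplitShrunk.lean
--file ComplexGFFStiffnessHypACumulantSplitShrunk.lean --workitem <this glue it -/
@[route_item "route-HubbardSuperconductivity-ComplexGFFStiffness"]
def HypACumulantGlue : Prop :=
  TwoKernelSkBound → L2GaussianCore → F4StatementOfCores → H1bcStatement → F1Residual → HypACumulant

-- `HypACumulantGlue` holds: proved by `Summit.HubbardSuperconductivity.HubbardSuperconductivity.Theorems.HypACumulantGlue_proof` (its module imports this route file, so no `_holds` link can be stated here).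

/-- item stmt-HubbardSuperconductivity-19155 · crux · rank 3 · closed · proved by Summit.HubbardSuperconductivity.HubbardSuperconductivity.Theorems.HypALocalTwoPoint_proof (prover) · by planner
why it might fail: the printed observable machinery gives bounded-range correlations via tangents of 𝒲_N only for perturbations in the Banach space E of the paper; cos(z_i/√K)·(1+𝒦_g) must lie in E with norm O(1) UNIFORMLY in K ≥ 1 — the K-uniformity of the ζ-norm is unchecked.
sources: AdamsBuchholzKoteckyMuller2019, arXiv:2007.10869
retired/moot children: TwoPointGivenZ [moot: Summit.HubbardSuperconductivity.HubbardSuperconductivity.Theorems.ComplexGFF.Two]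
[crux] hypothesis (A), local two-point form, N-uniform: ∃ L₀ ∀ L odd ≥ L₀ ∃ g₀ > 0, C: for 0 ≤ g ≤
g₀, N ≥ 1, n = L^N, K ≥ 1, every site x and axis i: Z_n(g,0) ≠ 0 and ‖⟨cos(∂_iφ(x)/√K)⟩_g −
⟨cos(∂_iφ(x)/√K)⟩_0‖ ≤ C·g (= Thm 2.2, ℓ = 1, along t ↦ t𝒦_g paired with the bounded-range
observable cos(z_i/√K), transcribed to the ι-symmetric class). [difficulty: L] -/
@[route_item "route-HubbardSuperconductivity-ComplexGFFStiffness", crux]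
def HypALocalTwoPoint : Prop :=
  ∃ L₀ : ℕ, ∀ L : ℕ, Odd L → L₀ ≤ L → ∃ g₀ C : ℝ, 0 < g₀ ∧ Literature.MathematicalPhysics.StatisticalMechanics.ComplexGradientGFF4.LocalTwoPointAt L g₀ C

-- `HypALocalTwoPoint` holds: proved by `Summit.HubbardSuperconductivity.HubbardSuperconductivity.Theorems.HypALocalTwoPoint_proof` (its module imports this route file, so no `_holds` link can be stated here).

-- parent: HypALocalTwoPoint · child (gen 1)
/--     item stmt-HubbardSuperconductivity-27384 · support · rank 302 · closed · proved by Summit.HubbardSuperconductivity.HubbardSuperconductivity.Theorems.ZNonvanishing_proof (prover)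
    parent: HypALocalTwoPoint · by planner
    why it might fail: none — proved in the tree (Theorems.ComplexGFF.zNonvanishing, standard axioms); listed only so that the glue TwoPointGivenZ → ZNonvanishing → HypALocalTwoPoint is by-name.
    sources: Theorems/ComplexGFFStiffnessHypACumulantStubGnvOfFrd.lean (zNonvanishing), AdamsBuchholzKoteckyMuller2019, Lemma 12.6 / Ch. 4
[support · IN TREE] N-uniform non-vanishing of the untilted complex partition function along the
tower (the shared first conjunct of both cruxes; verbatim stub_zNonvanishing of the birth skeletons;
def in Theorems/ComplexGFFStiffnessDefs) — PROVED: Theorems.ComplexGFF.zNonvanishing (from the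
landed gnv : GNV via zNonvanishing_of_gnv; files ComplexGFFStiffnessHypACumulantStubGnvOfFrd /
ComplexGFFStiffnessHypACumulantZOfGNV). Closes by the one-liner `theorem … :
…Theses.ComplexGFFStiffness.ZNonvanishing := Theorems.ComplexGFF.zNonvanishing` (in the evidence
file). NODE: piece WEAKER (a conjunct); leaf CLOSED-IN-TREE. -/
@[route_item "route-HubbardSuperconductivity-ComplexGFFStiffness", crux]
def ZNonvanishing : Prop :=
  Summit.HubbardSuperconductivity.HubbardSuperconductivity.Theorems.ComplexGFF.ZNonvanishing

-- `ZNonvanishing` holds: proved by `Summit.HubbardSuperconductivity.HubbardSuperconductivity.Theorems.ZNonvanishing_proof` (its module imports this route file, so no `_holds` link can be stated here).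

-- parent: HypALocalTwoPoint · glue (gen 1)
/--     item stmt-HubbardSuperconductivity-27385 · support · rank 303 · closed · proved by Summit.HubbardSuperconductivity.HubbardSuperconductivity.Theorems.HypALocalTwoPointGlue_proof (planner)
    parent: HypALocalTwoPoint · GLUE: children ⟹ parent · by planner
[glue] HypALocalTwoPointGlue : TwoPointGivenZ → ZNonvanishing → HypALocalTwoPoint — PROVED
sorry-free (std axioms) in the strategist's attached evidence file SplitCheck.lean /
ComplexGFFStiffnessHypACumulantSplitShrunk.lean (theorem hypALocalTwoPointGlue: the threshold merge
hypALocalTwoPoint_of_twoPointGivenZ, L₀ := max, g₀ := min — verbatim the composition of the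
registered skeleton Lines/gnv.lean with ZNonvanishing for GNV). TwoPointGivenZ itself closes by name
from the five RE-TYPED children of HypACumulant (twoPointGivenZ_item_of_cores: children ⟹
FreeEnergyBounds ⟹ twoPointGivenZ_of_freeEnergyBounds). Planners cannot write Theorems: any prover
lands the evidence file with --workitem <this glue item> (cstrat-19154 g1, 2026-08-31). -/
@[route_item "route-HubbardSuperconductivity-ComplexGFFStiffness"]
def HypALocalTwoPointGlue : Prop :=
  TwoPointGivenZ → ZNonvanishing → HypALocalTwoPoint

-- `HypALocalTwoPointGlue` holds: proved by `Summit.HubbardSuperconductivity.HubbardSuperconductivity.Theorems.HypALocalTwoPointGlue_proof` (its module imports this route file, so no `_holds` link can be stated here).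

/-- item stmt-HubbardSuperconductivity-19156 · assembly · rank 1 · closed · proved by Summit.HubbardSuperconductivity.HubbardSuperconductivity.Theorems.complexGFFStiffness_assembly_proof (prover) · by planner
sources: AdamsBuchholzKoteckyMuller2019
[assembly] HypACumulant → HypALocalTwoPoint → ComplexGFF4Stiffness (provable now:
stiffness_tower_of_hypA). -/
@[route_item "route-HubbardSuperconductivity-ComplexGFFStiffness"]
def Assembly : Prop :=
  HypACumulant → HypALocalTwoPoint → ComplexGFF4Stiffness

-- `Assembly` holds: proved by `Summit.HubbardSuperconductivity.HubbardSuperconductivity.Theorems.complexGFFStiffness_assembly_proof` (its module imports this route file, so no `_holds` link can be stated here).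

attribute [summit_statement] _root_.Summit.HubbardSuperconductivity.HubbardSuperconductivity.Theses.ComplexGFFStiffness.ComplexGFF4Stiffness

/-! D-0027 §2.1 — DECIDING THEOREM (planner-authored via `route open/edit --closes-file`; by planner-xylro-ideate-p3-g10-0 2026-08-26T00:04:04Z) — ARCHIVED: route closed (proved) 2026-08-31T22:03:56Z; kept so importers keep building:
its hypotheses are this route's items and its conclusion the registered leaf `Summit.HubbardSuperconductivity.HubbardSuperconductivity.Theses.ComplexGFFStiffness.ComplexGFF4Stiffness` (rung H2gff, D-0061) (glue_lint), and it elaborates with this file. -/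

@[closes "route-HubbardSuperconductivity-ComplexGFFStiffness"] theorem closes (h₁ : HypACumulant) (h₂ : HypALocalTwoPoint) :
    ComplexGFF4Stiffness := by
  have hA : Assembly := fun a b =>
    Literature.MathematicalPhysics.StatisticalMechanics.ComplexGradientGFF4.stiffness_tower_of_hypA a b
  exact hA h₁ h₂

end Summit.HubbardSuperconductivity.HubbardSuperconductivity.Theses.ComplexGFFStiffness
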